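import Summits.ABC.ABC.Theses.DefiniteXi
import Literature.NumberTheory.EllipticCurves.ModularDegreeQuadraticTwistProofs
import Literature.NumberTheory.EllipticCurves.BSDHeegnerPointsTorsionProofs
import HarnessLib

/-!
# Stub-ideation k2, generation 14 (HOME FAMILY 2 — RESHAPE) — `stub_primeToSixDegreeBound` (P6)
# crux `DefiniteXi.SteinbergCore` (stmt-ABC-15024), line `p6_tamagawa_split` (sha cda023e8)

Elaboration companion of `STUB-IDEAS-stub_primeToSixDegreeBound-2.md` (gen 14).  Gens 2–13 of this seat
(`STUB_IDEAS_stub_primeToSixDegreeBound_2_g2 … _g13.lean`, `…_g12_P6Ladder.lean`) stand by reference.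

New Family-2 cell of gen 14 — **quotient by the datum** (reformulate ∘ strengthen-to-all-data):

* `deg_mul_c_sq_eq` (M1, PROVED from tree theorems only): for two parametrisation data `D, D'` of the SAME
  model `W` at the SAME level `N`, `deg D · c(D')² = deg D' · c(D)²` — Zagier's formula
  (`deg_mul_covolume_eq_re`) for both data, the same newform (`ModularParametrizationData.f_eq`) and the same
  Néron lattice (uniformization uniqueness, via `IsNeronLatticeOf.covolume_eq_div_of_c₄_eq_of_c₆_eq` at `d = 1`).
  So `deg/c²` is an invariant of `(W, N)` ("Zagier ratio") and the degree spectrum of `(W, N)` is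
  `{deg D_min · (c/c_min)²}`; the tree's `exists_datum_deg_eq_sq_mul` (p162897) is the converse inclusion.
* `deg_le_deg_iff_natAbs_c_le` (M2, PROVED): `deg D ≤ deg D' ↔ |c(D)| ≤ |c(D')|`; hence the stub's
  second-order guard `∀ D', D.deg ≤ D'.deg` IS the guard `∀ D', |D.c| ≤ |D'.c|` (`minimal_iff_maninMinimal`).
* `StubManin` — the GUARD-FREE, Manin-weighted form of P6: `cps(deg D) ≤ C N^{2+ε} · c(D)²` for EVERY datum.
  `stubManin_of_stub` (M4, PROVED: M1 + multiplicativity of `cps` + a minimal datum exists) and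
  `stub_of_stubManin` (M3, PROVED modulo the binder `FreyManinBound` = k2 g2 / k3 g14's Frey–Manin bound,
  itself proved there from Pasten 2024 Cor 10.2 + optimal data + Mazur–Kenku):  **`Stub ⟺ StubManin`**.
Nothing here moves `∀ (a,b)`: `StubManin` at the minimal datum is k2 g10's `ManinHeightCredit` shape with
`H` replaced by `N^{1+ε}·six` — abc|Frey again.  Value: the minimality binder is eliminated from the stub's
TYPE (first-order weight `c²` instead of `∀ D'`), which is the form stub-1 / comparison provers and refuters
should quantify over.
-/

set_option linter.dupNamespace false

noncomputable section

namespace Summit.ABC.ABC.Cruxes.SteinbergCore.StubIdeas2G14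

open scoped Real
open Literature.NumberTheory.EllipticCurves Literature.NumberTheory.EllipticCurves.ModularForms
open CongruenceSubgroup

/-- The prime-to-`6` part `cps n = n / (2^{v₂ n} 3^{v₃ n})`, written exactly as in the route decl. [folklore] -/
def cps (n : ℕ) : ℕ := n / (ordProj[2] n * ordProj[3] n)

/-- The registered stub `stub_primeToSixDegreeBound` of `Lines/p6_tamagawa_split.lean`, verbatim
(= `StubIdeas2G13.Stub` = `StubIdeas3G14.Stub` = `StubIdeas1G2.P6`). [folklore] -/
def Stub : Prop :=
  ∀ ε : ℝ, 0 < ε → ∃ C : ℝ, ∀ a b : ℤ, IsCoprime a b → a * b * (a + b) ≠ 0 → ∀ (N : ℕ) [NeZero N],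
    (Literature.NumberTheory.EllipticCurves.freyCurve a b).conductorNorm ℤ = N →
    ∀ D : Literature.NumberTheory.EllipticCurves.ModularForms.ModularParametrizationData
      (Literature.NumberTheory.EllipticCurves.freyCurve a b) N,
      (∀ D' : Literature.NumberTheory.EllipticCurves.ModularForms.ModularParametrizationData
        (Literature.NumberTheory.EllipticCurves.freyCurve a b) N, D.deg ≤ D'.deg) →
      ((D.deg / (ordProj[2] D.deg * ordProj[3] D.deg) : ℕ) : ℝ) ≤ C * (N : ℝ) ^ (2 + ε)

/-- **StubManin — the guard-free, Manin-weighted form of P6.** For EVERY parametrisation datum `D` of a Frey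
curve at its conductor, `cps(deg D) ≤ C_ε · N^{2+ε} · c(D)²`.  No minimality binder. [folklore] -/
def StubManin : Prop :=
  ∀ ε : ℝ, 0 < ε → ∃ C : ℝ, ∀ a b : ℤ, IsCoprime a b → a * b * (a + b) ≠ 0 → ∀ (N : ℕ) [NeZero N],
    (freyCurve a b).conductorNorm ℤ = N →
    ∀ D : ModularParametrizationData (freyCurve a b) N,
      ((D.deg / (ordProj[2] D.deg * ordProj[3] D.deg) : ℕ) : ℝ) ≤ C * (N : ℝ) ^ (2 + ε) * (D.c : ℝ) ^ 2

/-- **FreyManinBound** (binder; = `StubIdeas2G2.FreyManinBound` / `StubIdeas3G14`, PROVED there modulo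
`PastenShimura2024_cor_10_2`, `exists_optimal_modularParametrizationData`, `mazurKenku_exists_cyclic_isogeny`):
Manin constants of SOME datum of each Frey curve at its conductor are uniformly bounded. [folklore] -/
def FreyManinBound : Prop :=
  ∃ M : ℕ, ∀ a b : ℤ, IsCoprime a b → a * b * (a + b) ≠ 0 →
    ∀ (N : ℕ) [NeZero N], (freyCurve a b).conductorNorm ℤ = N →
      ∃ D : ModularParametrizationData (freyCurve a b) N, D.c.natAbs ≤ M

/-- `FreyManinBound` is the k2 g2 / k3 g14 binder VERBATIM up to `δ`: `ModularParametrizationData.maninConstant D`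
is `D.c` by definition (`Literature/…/ModularCurve.lean:354`), so their `freyManinBound_of_facts`
(Pasten 2024 Cor. 10.2 + optimal data + Mazur–Kenku; Néron scaling = tree theorem) proves it by `exact`. -/
theorem freyManinBound_iff_maninConstant :
    FreyManinBound ↔ ∃ M : ℕ, ∀ a b : ℤ, IsCoprime a b → a * b * (a + b) ≠ 0 →
      ∀ (N : ℕ) [NeZero N], (freyCurve a b).conductorNorm ℤ = N →
        ∃ D : ModularParametrizationData (freyCurve a b) N, D.maninConstant.natAbs ≤ M :=
  Iff.rfl

/-! ### M1 — the Zagier ratio `deg / c²` is an invariant of `(W, N)` -/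

/-- **M1 (PROVED).** Two parametrisation data of the same model at the same level satisfy
`deg D · c(D')² = deg D' · c(D)²`: Zagier's formula `deg · covol(Λ_W) = 4π² c² (f, f)` for both, the newform
and the Néron lattice being the same for both data. [cite: ZagierCMB1985, §1 (p. 374)] -/
theorem deg_mul_c_sq_eq {W : WeierstrassCurve ℚ} {N : ℕ} [NeZero N]
    (D D' : ModularParametrizationData W N) :
    (D.deg : ℝ) * (D'.c : ℝ) ^ 2 = (D'.deg : ℝ) * (D.c : ℝ) ^ 2 := by
  have h1 := D.deg_mul_covolume_eq_re
  have h2 := D'.deg_mul_covolume_eq_re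
  have hf : D'.f = D.f := ModularParametrizationData.f_eq D' D
  have hcov : ZLattice.covolume D'.L.lattice = ZLattice.covolume D.L.lattice := by
    have h := IsNeronLatticeOf.covolume_eq_div_of_c₄_eq_of_c₆_eq (W := W.baseChange ℂ)
      (W' := W.baseChange ℂ) (d := (1 : ℂ)) one_ne_zero (by ring) (by ring) D.isNeronLattice D'.isNeronLattice
    simpa using h
  rw [hf, hcov] at h2
  have hpos : 0 < ZLattice.covolume D.L.lattice := ZLattice.covolume_pos _ _
  have key : ((D.deg : ℝ) * (D'.c : ℝ) ^ 2 - (D'.deg : ℝ) * (D.c : ℝ) ^ 2) *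
      ZLattice.covolume D.L.lattice = 0 := by
    linear_combination (D'.c : ℝ) ^ 2 * h1 - (D.c : ℝ) ^ 2 * h2
  exact sub_eq_zero.mp ((mul_eq_zero.mp key).resolve_right hpos.ne')

/-- M1 in `ℕ` with `|c|`. [folklore] -/
theorem deg_mul_natAbs_c_sq_eq {W : WeierstrassCurve ℚ} {N : ℕ} [NeZero N]
    (D D' : ModularParametrizationData W N) :
    D.deg * D'.c.natAbs ^ 2 = D'.deg * D.c.natAbs ^ 2 := by
  have h := deg_mul_c_sq_eq D D'
  have e1 : ((D.c.natAbs : ℕ) : ℝ) ^ 2 = (D.c : ℝ) ^ 2 := by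
    rw [Nat.cast_natAbs, Int.cast_abs, sq_abs]
  have e2 : ((D'.c.natAbs : ℕ) : ℝ) ^ 2 = (D'.c : ℝ) ^ 2 := by
    rw [Nat.cast_natAbs, Int.cast_abs, sq_abs]
  have h' : ((D.deg * D'.c.natAbs ^ 2 : ℕ) : ℝ) = ((D'.deg * D.c.natAbs ^ 2 : ℕ) : ℝ) := by
    push_cast
    rw [e1, e2]
    exact h
  exact_mod_cast h'

/-! ### M2 — minimal degree = minimal Manin constant -/

/-- **M2 (PROVED).** `deg D ≤ deg D' ↔ |c(D)| ≤ |c(D')|` (degrees positive, Manin constants non-zero). [folklore] -/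
theorem deg_le_deg_iff_natAbs_c_le {W : WeierstrassCurve ℚ} {N : ℕ} [NeZero N]
    (D D' : ModularParametrizationData W N) :
    D.deg ≤ D'.deg ↔ D.c.natAbs ≤ D'.c.natAbs := by
  have h := deg_mul_natAbs_c_sq_eq D D'
  have hd' : 0 < D'.deg := D'.deg_pos
  have hc0 : D.c ≠ 0 := D.maninConstant_ne_zero_holds
  have hc : 0 < D.c.natAbs := Int.natAbs_pos.mpr hc0
  constructor
  · intro hle
    -- `deg' · c² = deg · c'² ≤ deg' · c'²`
    have hmul : D'.deg * D.c.natAbs ^ 2 ≤ D'.deg * D'.c.natAbs ^ 2 := by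
      rw [← h]; exact Nat.mul_le_mul_right _ hle
    have hsq : D.c.natAbs ^ 2 ≤ D'.c.natAbs ^ 2 := Nat.le_of_mul_le_mul_left hmul hd'
    exact (Nat.pow_le_pow_iff_left two_ne_zero).mp hsq
  · intro hle
    have hsq : D.c.natAbs ^ 2 ≤ D'.c.natAbs ^ 2 := Nat.pow_le_pow_left hle 2
    have hc' : 0 < D'.c.natAbs ^ 2 := lt_of_lt_of_le (pow_pos hc 2) hsq
    have hmul : D.deg * D'.c.natAbs ^ 2 ≤ D'.deg * D'.c.natAbs ^ 2 := by
      rw [h]; exact Nat.mul_le_mul_left _ hsq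
    exact Nat.le_of_mul_le_mul_right hmul hc'

/-- The stub's guard is the Manin-minimality guard. [folklore] -/
theorem minimal_iff_maninMinimal {W : WeierstrassCurve ℚ} {N : ℕ} [NeZero N]
    (D : ModularParametrizationData W N) :
    (∀ D' : ModularParametrizationData W N, D.deg ≤ D'.deg) ↔
      (∀ D' : ModularParametrizationData W N, D.c.natAbs ≤ D'.c.natAbs) :=
  forall_congr' fun D' => deg_le_deg_iff_natAbs_c_le D D'

/-! ### Small arithmetic of `cps` -/

/-- `cps` is multiplicative (copy of `StubIdeas3G8.cps_mul`; tree: `SteinbergCore.Negative.primeToSix_mul`). [folklore] -/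
theorem cps_mul (m n : ℕ) : cps (m * n) = cps m * cps n := by
  have hcps : ∀ k : ℕ, cps k = ordCompl[3] (ordCompl[2] k) := by
    intro k
    have h3 : (ordCompl[2] k).factorization 3 = k.factorization 3 := by
      rw [Nat.factorization_div (Nat.ordProj_dvd k 2)]
      simp [Nat.prime_two.factorization_pow]
    change k / (ordProj[2] k * ordProj[3] k) = k / ordProj[2] k / 3 ^ (ordCompl[2] k).factorization 3
    rw [h3, Nat.div_div_eq_div_mul]
  rw [hcps, hcps, hcps, Nat.ordCompl_mul, Nat.ordCompl_mul]

theorem cps_le (n : ℕ) : cps n ≤ n := Nat.div_le_self _ _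

theorem one_le_cps {n : ℕ} (hn : n ≠ 0) : 1 ≤ cps n := by
  unfold cps
  rw [Nat.succ_le_iff, Nat.div_pos_iff]
  refine ⟨by positivity, Nat.le_of_dvd (Nat.pos_of_ne_zero hn) ?_⟩
  exact Nat.Coprime.mul_dvd_of_dvd_of_dvd (Nat.Coprime.pow _ _ (by norm_num))
    (Nat.ordProj_dvd n 2) (Nat.ordProj_dvd n 3)

/-- A minimal datum exists as soon as one datum does (well-ordering). [folklore] -/
theorem exists_min_datum {W : WeierstrassCurve ℚ} {N : ℕ} [NeZero N]
    (D₀ : ModularParametrizationData W N) :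
    ∃ D : ModularParametrizationData W N, ∀ D' : ModularParametrizationData W N, D.deg ≤ D'.deg := by
  classical
  have H : ∃ n : ℕ, ∃ D : ModularParametrizationData W N, D.deg = n := ⟨D₀.deg, D₀, rfl⟩
  obtain ⟨D, hD⟩ := Nat.find_spec H
  exact ⟨D, fun D' => hD ▸ Nat.find_min' H ⟨D', rfl⟩⟩

/-! ### M3 / M4 — `Stub ⟺ StubManin` (M3 modulo `FreyManinBound`) -/

/-- **M4 (PROVED).** The stub gives the guard-free Manin-weighted form:
`cps(deg D) · cps(c_min)² = cps(deg D_min) · cps(c_D)²` by M1, so `cps(deg D) ≤ cps(deg D_min) · c_D²`. [folklore] -/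
theorem stubManin_of_stub (hS : Stub) : StubManin := by
  intro ε hε
  obtain ⟨C, hC⟩ := hS ε hε
  refine ⟨max C 0, ?_⟩
  intro a b hab h0 N _ hN D
  obtain ⟨D₀, hD₀⟩ := exists_min_datum D
  have hmin := hC a b hab h0 N hN D₀ hD₀
  change ((cps D₀.deg : ℕ) : ℝ) ≤ C * (N : ℝ) ^ (2 + ε) at hmin
  change ((cps D.deg : ℕ) : ℝ) ≤ max C 0 * (N : ℝ) ^ (2 + ε) * (D.c : ℝ) ^ 2
  have key : D.deg * D₀.c.natAbs ^ 2 = D₀.deg * D.c.natAbs ^ 2 := deg_mul_natAbs_c_sq_eq D D₀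
  have hc0 : D₀.c ≠ 0 := D₀.maninConstant_ne_zero_holds
  have hsq : D₀.c.natAbs ^ 2 ≠ 0 := pow_ne_zero 2 (Int.natAbs_ne_zero.mpr hc0)
  have hnat : cps D.deg ≤ cps D₀.deg * D.c.natAbs ^ 2 :=
    calc cps D.deg ≤ cps D.deg * cps (D₀.c.natAbs ^ 2) :=
          Nat.le_mul_of_pos_right _ (one_le_cps hsq)
      _ = cps (D.deg * D₀.c.natAbs ^ 2) := (cps_mul _ _).symm
      _ = cps (D₀.deg * D.c.natAbs ^ 2) := by rw [key]
      _ = cps D₀.deg * cps (D.c.natAbs ^ 2) := cps_mul _ _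
      _ ≤ cps D₀.deg * D.c.natAbs ^ 2 := Nat.mul_le_mul_left _ (cps_le _)
  have hreal : ((cps D.deg : ℕ) : ℝ) ≤ ((cps D₀.deg : ℕ) : ℝ) * (D.c : ℝ) ^ 2 := by
    have e1 : ((D.c.natAbs : ℕ) : ℝ) ^ 2 = (D.c : ℝ) ^ 2 := by
      rw [Nat.cast_natAbs, Int.cast_abs, sq_abs]
    rw [← e1]
    exact_mod_cast hnat
  have hNp : (0 : ℝ) ≤ (N : ℝ) ^ (2 + ε) := Real.rpow_nonneg (Nat.cast_nonneg N) _
  have hmin' : ((cps D₀.deg : ℕ) : ℝ) ≤ max C 0 * (N : ℝ) ^ (2 + ε) :=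
    hmin.trans (mul_le_mul_of_nonneg_right (le_max_left C 0) hNp)
  calc ((cps D.deg : ℕ) : ℝ) ≤ ((cps D₀.deg : ℕ) : ℝ) * (D.c : ℝ) ^ 2 := hreal
    _ ≤ max C 0 * (N : ℝ) ^ (2 + ε) * (D.c : ℝ) ^ 2 :=
        mul_le_mul_of_nonneg_right hmin' (sq_nonneg _)

/-- **M3 (PROVED modulo the binder `FreyManinBound`).** The guard-free form gives the stub: at a MINIMAL datum
`|c_D| ≤ |c_{D₁}| ≤ M` for the bounded-Manin datum `D₁` (M2), so `cps(deg D) ≤ C N^{2+ε} c_D² ≤ C M² N^{2+ε}`.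
[folklore] -/
theorem stub_of_stubManin (hM : FreyManinBound) (hS : StubManin) : Stub := by
  obtain ⟨M, hM⟩ := hM
  intro ε hε
  obtain ⟨C, hC⟩ := hS ε hε
  refine ⟨max C 0 * (M : ℝ) ^ 2, ?_⟩
  intro a b hab h0 N _ hN D hDmin
  obtain ⟨D₁, hD₁⟩ := hM a b hab h0 N hN
  have hcle : D.c.natAbs ≤ D₁.c.natAbs := (deg_le_deg_iff_natAbs_c_le D D₁).mp (hDmin D₁)
  have hcM : ((D.c.natAbs : ℕ) : ℝ) ≤ (M : ℝ) := by exact_mod_cast hcle.trans hD₁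
  have hcsq : (D.c : ℝ) ^ 2 ≤ (M : ℝ) ^ 2 := by
    have e1 : ((D.c.natAbs : ℕ) : ℝ) ^ 2 = (D.c : ℝ) ^ 2 := by
      rw [Nat.cast_natAbs, Int.cast_abs, sq_abs]
    rw [← e1]
    exact pow_le_pow_left₀ (Nat.cast_nonneg _) hcM 2
  have h := hC a b hab h0 N hN D
  have hNp : (0 : ℝ) ≤ (N : ℝ) ^ (2 + ε) := Real.rpow_nonneg (Nat.cast_nonneg N) _
  have hK : 0 ≤ max C 0 * (N : ℝ) ^ (2 + ε) := mul_nonneg (le_max_right C 0) hNp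
  calc ((D.deg / (ordProj[2] D.deg * ordProj[3] D.deg) : ℕ) : ℝ)
      ≤ C * (N : ℝ) ^ (2 + ε) * (D.c : ℝ) ^ 2 := h
    _ ≤ max C 0 * (N : ℝ) ^ (2 + ε) * (D.c : ℝ) ^ 2 := by
        gcongr
        exact le_max_left C 0
    _ ≤ max C 0 * (N : ℝ) ^ (2 + ε) * (M : ℝ) ^ 2 := mul_le_mul_of_nonneg_left hcsq hK
    _ = max C 0 * (M : ℝ) ^ 2 * (N : ℝ) ^ (2 + ε) := by ring

/-- **Headline (PROVED modulo the binder `FreyManinBound`).** The registered stub and its guard-free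
Manin-weighted form are equivalent: `Stub ⟺ StubManin`.  The weight `c(D)²` is exactly what absorbs the
tree's witness `[5^k] ∘ φ₀` of `primeToSixDegreeBound_false_without_minimality` (p162897: `c ↦ 5^k c`,
`deg ↦ 25^k deg`), and by M1 that witness is the ONLY freedom at fixed `(W, N)`. [folklore] -/
theorem stub_iff_stubManin (hM : FreyManinBound) : Stub ↔ StubManin :=
  ⟨stubManin_of_stub, stub_of_stubManin hM⟩

end Summit.ABC.ABC.Cruxes.SteinbergCore.StubIdeas2G14

end
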